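import Mathlib
import HarnessLib
import Summits.HubbardSuperconductivity.HubbardSuperconductivity.Theorems.KLProgrammeSectorisedLegKernelsDefs
import Summits.HubbardSuperconductivity.HubbardSuperconductivity.Theorems.KLProgrammeCooperVertexBlocksDefs

/-!
# Route `KLProgramme` — definitions: the non-Cooper half of child 1 `KLRegimeBetaSplit`
# (isotropic sector ARRAYS of the leg kernels, scale coarsening, sector vectors, the shell bubble mass)

Cell gate-hubbard-kl, seat p3 (plan g8 ruling 04:10:52Z «p3 → the NON-COOPER HALF vocabulary, own module
`Theorems/KLProgrammeNonCooperKernelsDefs.lean`»; texts HOME/prover-p1b/BETASPLIT-PRED.md §2 (B3), §5).  Over eng's D1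
(`KLProgrammeSectorisedLegKernelsDefs.lean`: `klLegKernel`, `klIsoFamily`, `klSectorMomentum`, `klPPTransfer`, `IsCooperClassAt`, …)
and p3's D2 (`KLProgrammeCooperVertexBlocksDefs.lean`: `cooperOp`), this file adds exactly the objects (B3) quantifies over —
definitions with bodies and `rfl`/arithmetic lemmas, no analytic claim:

* `klIsoCoeff … n m Ω̄` — the ZERO-MOMENTUM FOURIER COEFFICIENT (in the sector frames) of the isotropic-sectorised
  `(m+1)`-leg kernel at scale `h = -n`: `ε_x^m Σ_{x₂…x_{m+1}} W̄_{h,Ω̄}(0, x₂, …, x_{m+1})` (`ε_x = imagTimeWeight β M`; translation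
  invariance makes the choice `x₁ = 0` immaterial) — App. E E1's array entry; **`klIsoArray … n Ω̄`** — the quartic case `m + 1 = 4`:
  BGM's running coupling `λ_h` read on the isotropic sector 4-tuple `Ω̄` («`V_h(Ω̄)`» of DECOMP App. E E1/E2);
* `coarsenIdx n t`, `coarsenLeg n t`, `coarsen n t` — the isotropic sector at scale `n` ↦ the scale-`t` sector containing it
  (index `ω̄ ↦ ⌊ω̄ / 4^{n-t}⌋`; spins and charges kept), so that (B3)(b) «exited at scale `t`: `|klIsoArray n Ω̄ - klIsoArray t (coarsen Ω̄)| ≤ …`»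
  typechecks; `coarsenIdx_val`, `coarsenIdx_self`, `isBGMOrdered_coarsen`;
* `sectorVec L n ω̄` — the (unnormalised) sector vector `k ↦ ζ̄_{n,ω̄}(θ(k))` on the torus carrier `ℓ²((ℤ/Lℤ)²)`, and
  **`klCooperSectorElem … n ω̄_out ω̄_in`** — the normalised matrix element of D2's scale-`n` Cooper operator between two sector vectors
  ((B3)(c): «the array IS the block object up to `C_W U²`»);
* **`klShellMass … j`** — the BCS-measure mass of the shell slice `{Λ_j < |e_K| ≤ Λ_{j-1}}` of D2's `cooperMatrix` normalisation
  (`bcsMeasure`): a candidate model binding of E.4's single-scale bubble mass `bmass j` UP TO NORMALISATION (the flat shell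
  weight `1/Λ_j` of `bcsMeasure` gives `≈ (γ - 1)·` DOS mass per slice, not the BCS logarithm `ln γ ·` DOS mass of C2-KILLTEST (A) /
  ref-3 NIT-17; the conversion is part of the binding); a parameter of child 1 until E.4 fixes the binding.

References: HOME/prover-p1b/BETASPLIT-PRED.md; HOME/DECOMP.md v7.2 §8(h) 3, App. E E1–E2; G. Benfatto, A. Giuliani,
V. Mastropietro, Ann. Henri Poincaré 7 (2006) 809, §2.5 (2.57), §2.7 (2.70)–(2.71), §3 (3.65).
-/

noncomputable section

namespace Summit.HubbardSuperconductivity.HubbardSuperconductivity.Theorems.KLProgrammeLegKernels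

set_option linter.dupNamespace false -- summit = problem name (single-conjunct summit), D-0017

open scoped InnerProductSpace
open Real Literature.MathematicalPhysics.QuantumLattice Literature.Probability.LatticeModels
open Summit.HubbardSuperconductivity.HubbardSuperconductivity.Theorems.CooperVertexBlocks

variable (L M : ℕ) [NeZero L] [NeZero M]

/-! ### Zero-momentum Fourier coefficients of the sectorised leg kernels (App. E E1's arrays) -/

/-- **The zero-momentum coefficient of the isotropic `(m+1)`-leg kernel at scale `h = -n`** on the label tuple `Ω̄`:
`ε_x^m Σ_{x₂,…,x_{m+1}} W̄_{h,Ω̄}(0, x₂, …, x_{m+1})`, `ε_x = imagTimeWeight β M` (one leg pinned at the origin, the others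
integrated with `∫dx = ε_x Σ_x`; by translation invariance of the kernels the pinned point is immaterial). -/
def klIsoCoeff (β U μ : ℝ) (K : TrigPolyC4v) (e₀ : ℝ) (n m : ℕ) (Ω : Fin (m + 1) → SectorLeg (sectorCount (2 * n))) : ℂ :=
  ((imagTimeWeight β M ^ m : ℝ) : ℂ) *
    ∑ x : Fin m → SpaceTimeIdx L M, klLegKernel L M β U μ K e₀ n (m + 1) Ω (Matrix.vecCons (0 : SpaceTimeIdx L M) x)

/-- **The isotropic quartic array at scale `h = -n`**: `V̄_h(Ω̄) = ε_x³ Σ_{x₂,x₃,x₄} λ̄_{h,Ω̄}(0, x₂, x₃, x₄)` — BGM's running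
coupling function read on the isotropic sector 4-tuple `Ω̄` (App. E E1/E2; the object of (B3) of child 1). -/
def klIsoArray (β U μ : ℝ) (K : TrigPolyC4v) (e₀ : ℝ) (n : ℕ) (Ω : Fin 4 → SectorLeg (sectorCount (2 * n))) : ℂ :=
  klIsoCoeff L M β U μ K e₀ n 3 Ω

/-! ### Coarsening of isotropic sectors from scale `n` to a coarser scale `t ≤ n` -/

omit [NeZero L] [NeZero M] in
/-- Arithmetic of the coarsening: `ω̄ < 2·4ⁿ ⇒ ω̄ / 4^{n-t} < 2·4ᵗ` for `t ≤ n`. -/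
theorem div_pow_lt_sectorCount {n t : ℕ} (ht : t ≤ n) (ω : Fin (sectorCount (2 * n))) :
    ω.val / 4 ^ (n - t) < sectorCount (2 * t) := by
  have hω := ω.isLt
  rw [Nat.div_lt_iff_lt_mul (by positivity)]
  have h : sectorCount (2 * n) = sectorCount (2 * t) * 4 ^ (n - t) := by
    simp only [sectorCount]
    rw [show (4 : ℕ) = 2 ^ 2 by norm_num, ← pow_mul, ← pow_add]
    congr 1
    omega
  rw [← h]
  exact hω

/-- **Coarsening of an isotropic sector index** from scale `n` to scale `t`: `ω̄ ↦ ⌊ω̄ / 4^{n-t}⌋` — the scale-`t` isotropic sector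
(width `π 4^{-t}`) containing the scale-`n` sector `ω̄` (width `π 4^{-n}`); total by reduction modulo `sectorCount (2t)`, which is the
identity for `t ≤ n` (`coarsenIdx_val`). -/
def coarsenIdx (n t : ℕ) (ω : Fin (sectorCount (2 * n))) : Fin (sectorCount (2 * t)) :=
  ⟨(ω.val / 4 ^ (n - t)) % sectorCount (2 * t), Nat.mod_lt _ (sectorCount_pos _)⟩

/-- Coarsening of a leg label: the sector index is coarsened, spin and charge are kept. -/
def coarsenLeg (n t : ℕ) (ℓ : SectorLeg (sectorCount (2 * n))) : SectorLeg (sectorCount (2 * t)) :=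
  ((coarsenIdx n t ℓ.1.1, ℓ.1.2), ℓ.2)

/-- Coarsening of a label tuple, leg by leg. -/
def coarsen (n t : ℕ) {m : ℕ} (Ω : Fin m → SectorLeg (sectorCount (2 * n))) : Fin m → SectorLeg (sectorCount (2 * t)) :=
  fun i => coarsenLeg n t (Ω i)

omit [NeZero L] [NeZero M] in
/-- For `t ≤ n` the coarsened index is `ω̄ / 4^{n-t}` (no wrap-around). -/
theorem coarsenIdx_val {n t : ℕ} (ht : t ≤ n) (ω : Fin (sectorCount (2 * n))) :
    (coarsenIdx n t ω).val = ω.val / 4 ^ (n - t) := by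
  simp only [coarsenIdx]
  exact Nat.mod_eq_of_lt (div_pow_lt_sectorCount ht ω)

omit [NeZero L] [NeZero M] in
/-- Coarsening to the same scale is the identity. -/
theorem coarsenIdx_self (n : ℕ) (ω : Fin (sectorCount (2 * n))) : coarsenIdx n n ω = ω := by
  apply Fin.ext
  rw [coarsenIdx_val le_rfl, Nat.sub_self, pow_zero, Nat.div_one]

omit [NeZero L] [NeZero M] in
/-- Coarsening keeps BGM field order (charges `+,-,+,-`, spins `σ,σ,σ',σ'`). -/
theorem isBGMOrdered_coarsen (n t : ℕ) {Ω : Fin 4 → SectorLeg (sectorCount (2 * n))} (hΩ : IsBGMOrdered Ω) :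
    IsBGMOrdered (coarsen n t Ω) := by
  simpa [IsBGMOrdered, coarsen, coarsenLeg] using hΩ

/-! ### Sector vectors on the torus carrier and the sector-pair element of the Cooper operator ((B3)(c)) -/

/-- **The sector vector** of the isotropic sector `ω̄` at scale `n` on the torus carrier `ℓ²((ℤ/Lℤ)²)`:
`e_ω̄(k⃗) = ζ̄_{n,ω̄}(θ(k⃗))`, the angular weight (`sectorWeightCirc (2n) ω̄`) of the lattice momentum `k⃗` at its polar angle
`momentumAngle L k⃗` (unnormalised; `Σ_ω̄ e_ω̄ = 1` pointwise by the partition of unity). -/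
def sectorVec (n : ℕ) (ω : Fin (sectorCount (2 * n))) : EuclideanSpace ℂ (TorusSite 2 L) :=
  WithLp.toLp 2 fun k => ((sectorWeightCirc (2 * n) ω (momentumAngle L k) : ℝ) : ℂ)

/-- **The sector-pair matrix element of the scale-`n` Cooper operator** of the KL programme (D2's `cooperOp` of
`klEffectiveAction … n` on the band `e_K` at scale `Λ_n`): `⟪e_out, A_n e_in⟫ / (‖e_out‖ ‖e_in‖)` (junk `0/0 = 0` for an empty
sector at small `L`) — the object (B3)(c) compares with the array `klIsoArray` on Cooper-class 4-tuples. -/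
def klCooperSectorElem (β U μ : ℝ) (K : TrigPolyC4v) (e₀ : ℝ) (n : ℕ) (ωout ωin : Fin (sectorCount (2 * n))) : ℂ :=
  ⟪sectorVec L n ωout,
      cooperOp L M β (nambuXiCT L μ K) (klScale e₀ n) (klEffectiveAction L M β U μ K e₀ n) (sectorVec L n ωin)⟫_ℂ /
    ((‖sectorVec L n ωout‖ * ‖sectorVec L n ωin‖ : ℝ) : ℂ)

/-! ### The shell bubble mass (candidate binding of `bmass j`) -/

/-- **The BCS-measure mass of the scale-`j` shell slice** `{k⃗ : Λ_j < |e_K(k⃗)| ≤ Λ_{j-1}}` (`Λ_j = klScale e₀ j`) in the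
normalisation of D2's `cooperMatrix`: `Σ_{k⃗ ∈ slice} ν_{Λ_j}(k⃗)`, `ν` = `bcsMeasure` of the scale-`j` action.  In this normalisation
the one-loop flow of a Cooper eigenvalue is `dλ/d log(Λ/Λ') = λ²`.  SIZE: with the flat shell weight `1/Λ_j` of `ν_{Λ_j}` the slice
mass is `≈ ((Λ_{j-1} - Λ_j)/Λ_j) · σ_F/((2π)² z) = (γ - 1) ·` (DOS mass), whereas the single-scale BCS bubble mass that E.4's `bmass j`
denotes is `ln γ ·` (DOS mass per unit weight of the block carrier) — so this is a CANDIDATE binding up to the normalisation factor fixed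
by the weight the block object carries (`klSectorWeight` of `KLProgrammeLocalisedCooperDefs.lean`); empty slice (`0`) at `j = 0`.
[CORRECTED docstring, p3 g2 06:20Z: the earlier text's «≈ ln 4 per scale» conflated the two normalisations.] -/
def klShellMass (β U μ : ℝ) (K : TrigPolyC4v) (e₀ : ℝ) (j : ℕ) : ℝ :=
  ∑ k ∈ momentumShell L (nambuXiCT L μ K) (klScale e₀ (j - 1)) \ momentumShell L (nambuXiCT L μ K) (klScale e₀ j),
    bcsMeasure L M β (klScale e₀ j) (klEffectiveAction L M β U μ K e₀ j) k

/-- Unfolding `klIsoArray`. -/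
theorem klIsoArray_eq (β U μ : ℝ) (K : TrigPolyC4v) (e₀ : ℝ) (n : ℕ) (Ω : Fin 4 → SectorLeg (sectorCount (2 * n))) :
    klIsoArray L M β U μ K e₀ n Ω = ((imagTimeWeight β M ^ 3 : ℝ) : ℂ) *
      ∑ x : Fin 3 → SpaceTimeIdx L M, klLegKernel L M β U μ K e₀ n 4 Ω (Matrix.vecCons (0 : SpaceTimeIdx L M) x) :=
  rfl

end Summit.HubbardSuperconductivity.HubbardSuperconductivity.Theorems.KLProgrammeLegKernels

end
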